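import Summits.QuantumFields.YangMills.Theorems.UnitScaleTiltProp7SectET3NormG
import Literature.MathematicalPhysics.QuantumFieldTheory.Balaban1983to89.B9Ineq347CoReading
import HarnessLib

/-!
# Route `UnitScaleTilt`, crux «MinimiserStabilityRegPr» (stmt-QuantumFields-19200, v10 stub EX, route (α), node N06(d = 3)) — the `norm_G` half of the knit, CONSISTENCY OF ITS PINS:
# **THE CANONICAL (3.47) GLOBAL ENTRIES OF A MODEL OPERATOR** — the twin of ✓ `Prop7SectET3NormH1Canonical` for Theorem 3.13's side: for ANY ℝ-linear model operators read at the
# entries n = 0, 1, 2 of (3.47) there IS a kernel family `K : B9.KernelFamily` whose `glob` entries satisfy AT ONCE the Theorem 3.13 leaf's co-readings `CoReadsGlob` (entries ≤ every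
# valid bound — «the smallest number C such that …», (3.41)) AND the converse domination the `norm_G` consumer reads (operator ≤ entries): `glob n U λ γ := sup_x |(A(ev λ))(x)| ∕
# ([(Lʲη)², Lʲη, Lʲη, 1]_n·(L^{j(x)}η)^γ)`

Cell `ym3-torus` (HUMAN RULING D-0037, YM ladder rung R3 — NOT the Clay problem), width seat ym-ust-20520-w1 g4 (the `norm_G` twin of the seat's `norm_H₁` lane; ★w2-20520 g2's
`Prop7SectE115WNormDict` HONEST SCOPE «the consumer still owes the DEFINITION of the T³ KernelFamily's `glob` entries as these weighted sups» — here discharged at the ℝ-model level,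
def-free, inside an `∃`).  Count-neutral helper (`--supports stmt-QuantumFields-19200 --as helper`); registry untouched; THEOREMS ONLY (0 `def`, 0 `sorry`); Mathlib-only over
`B9Ineq347CoReading`; NOTHING of [Balaban1985BackgroundPropagators] is asserted.

THE PRINT ∕ THE TREE.  [Balaban1985BackgroundPropagators] (3.41) p. 397: *«|A|_{(α)} = sup_j sup_{b∈Ω_j∖Ω_{j+1}} (Lʲη)^{−α}|A(b)| … the smallest number C such, that |A(b)| ≦ C(Lʲη)^α»*;
(3.47) p. 398: *«|Gλ|_{(2+γ)}, |∇_U Gλ|_{(1+γ)}, |G∇*_Uλ|_{(1+γ)}, |Δ_U Gλ|_{(γ)} ≦ B₀|λ|_{(γ)}»*.  The tree carries the four left-hand sides as REALS `B9.KernelFamily.glob n U λ γ`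
pinned to the model operators of the Theorem 3.13 leaf (`(𝔬 i).G U`, `(𝔬 i).D U ∘ (𝔬 i).G U`, `(𝔬 i).G U ∘ (𝔬 i).Dstar U`) ONLY through `B9Ineq347CoReading.CoReadsGlob.obs` («every valid
C bounds the entry», i.e. `glob ≤ sup`); the `norm_G` consumer ✓ `Prop7SectET3NormG.normG_of_thm313Printed` ∕ `…RecordNormG.normG_row_of_recordObligations` reads `glob 0`, `glob 1` at
`γ = −3` as UPPER bounds of the operator (`hglob`), i.e. needs `sup ≤ glob`.  THIS FILE shows both schemas are JOINTLY inhabited by `glob := sup` (the (3.41) definition itself), so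
displaying the leaf's `hcoG` and the consumer's `hglob` for the SAME `GG` is consistent; the other five fields of `B9.KernelFamily` (`e`, `h1`, `e4`, `h2`, `l2`) and the Laplacian
entry `glob 3` are free parameters here (their co-readings `CoRealizesRel` ∕ `H1ReadsNbr` ∕ `InputReadsFam` ∕ `L2ReadsNbr` are untouched; the `norm_G` pin reads none of them).

WHAT IS PROVED (ns `…Theorems.Prop7SectET3NormGCanonical`).
* §1 ★★ `exists_glob_canonical` — for one entry index `n`, a background-indexed ℝ-linear family `A U`,
  the output block map `bu` and the argument evaluation `ev`: `∃ gl : Cfg → Loc → ℝ → ℝ` with (i) `0 ≤ gl`, (ii) the CO-READING clause of `CoReadsGlob.obs` (minimality of the sup),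
  (iii) DOMINATION `|(A U (ev λ))(x)| ≤ gl U λ γ·pref4(len(bu x)) n·len(bu x)^γ` at every output `x` (maximality) — the finite sup over the output lattice.
* §2 ★★★ `exists_kernelFamily_glob_canonical` — for the THREE operators of the leaf's `hcoG` (entries n = 0, 1, 2, each with its own `(bu, bv, ev)`), their (3.41) argument bounds
  `wbound` and ANY remaining fields: `∃ K : B9.KernelFamily g B` with those fields, `CoReadsGlob K n U buₙ bvₙ evₙ (Aₙ U)` for n = 0, 1, 2 and every `U` (the leaf's `hcoG` conjuncts
  for this family), `0 ≤ K.glob n` and the three dominations — in particular at `γ = −3`, n = 0, 1: the readings `hglob` of the `norm_G` consumer for the ℝ-model of `𝔊(U₀)`.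
HONEST SCOPE: finite suprema ([folklore]); no estimate of [B9]; the route's M₂(ℂ)-valued letter `𝒢f` is still not DEFINED (NE9 (L2) + the 𝔰𝔲(2)-coordinates dictionary); N06(d = 3)
NOT discharged; nothing here claims EX, the crux, V3∕R3, d = 4 or the mass gap; YM₃ on T³ is ladder rung R3, not the Clay problem.

References: T. Bałaban, CMP 99 (1985) 389–434 [Balaban1985BackgroundPropagators] ((3.41)–(3.42) p.397, (3.47) p.398, Thm 3.13 p.426); CMP 102 (1985) 277–309 [Balaban1985Variational]
((117) p.295).
-/

set_option autoImplicit false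

noncomputable section

namespace Summit.QuantumFields.YangMills.Theorems.Prop7SectET3NormGCanonical

open Literature.MathematicalPhysics.QuantumFieldTheory.Balaban1983to89
open Literature.MathematicalPhysics.QuantumFieldTheory.Balaban1983to89.B9Ineq347CoReading (CoReadsGlob)

/-! ## §1 One entry: the canonical global quantity as a finite sup over the output lattice -/

section OneEntry

variable {g : B9.Geometry} {B : B9.Backgrounds} {u v : Type} [Fintype u]

/-- ★★ **THE CANONICAL GLOBAL ENTRY OF ONE BACKGROUND-INDEXED OPERATOR**: `gl U λ γ := sup ({0} ∪ {|(A U (ev λ))(x)| ∕ (pref4(len(bu x)) n · len(bu x)^γ) : x})` — a FINITE sup over the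
output lattice — has (i) `0 ≤ gl`, (ii) the co-reading clause of `CoReadsGlob.obs` (the entry is BELOW every valid bound: print's «smallest number C such that …»), (iii) DOMINATION of the
operator BY the entry at every output point. [cite: Balaban1985BackgroundPropagators, (3.41) p.397, (3.47) p.398] -/
theorem exists_glob_canonical (n : Fin 4) (bu : u → g.Site) (ev : g.Loc → v → ℝ) (A : B.Cfg → (v → ℝ) →ₗ[ℝ] (u → ℝ))
    (hlen : ∀ y : g.Site, 0 < g.len y) :
    ∃ gl : B.Cfg → g.Loc → ℝ → ℝ,
      (∀ U lam γ, 0 ≤ gl U lam γ) ∧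
      (∀ (U : B.Cfg) (lam : g.Loc) (γ C : ℝ), 0 ≤ C →
        (∀ x : u, |A U (ev lam) x| ≤ C * B9.pref4 (g.len (bu x)) n * g.len (bu x) ^ γ) → gl U lam γ ≤ C) ∧
      (∀ (U : B.Cfg) (lam : g.Loc) (γ : ℝ) (x : u), |A U (ev lam) x| ≤ gl U lam γ * B9.pref4 (g.len (bu x)) n * g.len (bu x) ^ γ) := by
  classical
  -- the weight at an output point and the (finite) entry sets
  -- positivity of the prefactors `[(Lʲη)², Lʲη, Lʲη, 1]_n` (the tree's `BalabanUVNodes.N15.OperatorReadout.pref4_pos`, inlined to keep the imports light)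
  have hpref : ∀ t : ℝ, 0 < t → 0 < B9.pref4 t n := fun t ht => by
    fin_cases n <;> simp [B9.pref4] <;> positivity
  have hp : ∀ (γ : ℝ) (x : u), 0 < B9.pref4 (g.len (bu x)) n * g.len (bu x) ^ γ :=
    fun γ x => mul_pos (hpref _ (hlen (bu x))) (Real.rpow_pos_of_pos (hlen (bu x)) γ)
  let S : B.Cfg → g.Loc → ℝ → Set ℝ := fun U lam γ =>
    insert 0 (Set.range fun x : u => |A U (ev lam) x| / (B9.pref4 (g.len (bu x)) n * g.len (bu x) ^ γ))
  have hbdd : ∀ U lam γ, BddAbove (S U lam γ) := fun U lam γ => ((Set.finite_range _).insert 0).bddAbove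
  have hne : ∀ U lam γ, (S U lam γ).Nonempty := fun U lam γ => ⟨0, Set.mem_insert 0 _⟩
  refine ⟨fun U lam γ => sSup (S U lam γ), fun U lam γ => le_csSup (hbdd U lam γ) (Set.mem_insert 0 _), fun U lam γ C hC hobs => ?_, fun U lam γ x => ?_⟩
  · -- (ii) minimality
    refine csSup_le (hne U lam γ) fun r hr => ?_
    rcases Set.mem_insert_iff.1 hr with h0 | ⟨x, rfl⟩
    · rw [h0]; exact hC
    · rw [div_le_iff₀ (hp γ x), ← mul_assoc]
      exact hobs x
  · -- (iii) domination
    have hle : |A U (ev lam) x| / (B9.pref4 (g.len (bu x)) n * g.len (bu x) ^ γ) ≤ sSup (S U lam γ) :=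
      le_csSup (hbdd U lam γ) (Set.mem_insert_of_mem 0 ⟨x, rfl⟩)
    rw [div_le_iff₀ (hp γ x), ← mul_assoc] at hle
    exact hle

end OneEntry

/-! ## §2 The canonical kernel family for the three operators of the leaf's (3.47) co-readings -/

section ThreeEntries

variable {g : B9.Geometry} {B : B9.Backgrounds} {u₀ v₀ u₁ v₁ u₂ v₂ : Type} [Fintype u₀] [Fintype u₁] [Fintype u₂]

/-- ★★★ **THE CANONICAL KERNEL FAMILY FOR (3.47)₀,₁,₂**: for the three ℝ-linear model operators of Theorem 3.13's global co-readings (at the T³ leaf `(𝔬 i).G U` on `(blk, blk, ev)`,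
`(𝔬 i).D U ∘ₗ (𝔬 i).G U` on `(blkY, blk, ev)`, `(𝔬 i).G U ∘ₗ (𝔬 i).Dstar U` on `(blk, blkY, evY)`), their (3.41) argument bounds `wbound` (the structural half of `CoReadsGlob`, a property of the
evaluation maps and `wNorm`, displayed), and ANY remaining fields `e h1 e4 h2 l2` and Laplacian entry `g3`: there is `K : B9.KernelFamily g B` with exactly those fields, `K.glob 3 = g3`,
the leaf's co-readings `CoReadsGlob K n U buₙ bvₙ evₙ (Aₙ U)` (n = 0, 1, 2, every `U`), `0 ≤ K.glob n` (n = 0, 1, 2) and the DOMINATIONS `|(Aₙ U (evₙ λ))(x)| ≤ K.glob n U λ γ ·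
pref4(len(buₙ x)) n · len(buₙ x)^γ` — at `γ = −3`, n = 0, 1 these are the `hglob` readings of ✓ `normG_of_thm313Printed` for the ℝ-model of `𝔊(U₀)` (`|𝔊λ|(x) ≤ glob₀·(Lʲη)²·(Lʲη)⁻³`,
`|∇𝔊λ|(x) ≤ glob₁·(Lʲη)·(Lʲη)⁻³`).  So `hcoG` and the `norm_G` pin are consistent displayed rows for ONE family. [cite: Balaban1985BackgroundPropagators, (3.41) p.397, (3.47) p.398, Thm 3.13 p.426; Balaban1985Variational, (117) p.295] -/
theorem exists_kernelFamily_glob_canonical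
    (e : Fin 4 → B.Cfg → g.Loc → g.Site → ℝ) (h1 : B.Cfg → g.Loc → ℝ → g.Cut → ℝ) (e4 : B.Cfg → g.Loc → g.Site → ℝ) (h2 : B.Cfg → g.Loc → ℝ → g.Cut → ℝ)
    (l2 : Fin 6 → B.Cfg → g.Loc → g.Cut → ℝ) (g3 : B.Cfg → g.Loc → ℝ → ℝ)
    (bu₀ : u₀ → g.Site) (bv₀ : v₀ → g.Site) (ev₀ : g.Loc → v₀ → ℝ) (A₀ : B.Cfg → (v₀ → ℝ) →ₗ[ℝ] (u₀ → ℝ))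
    (bu₁ : u₁ → g.Site) (bv₁ : v₁ → g.Site) (ev₁ : g.Loc → v₁ → ℝ) (A₁ : B.Cfg → (v₁ → ℝ) →ₗ[ℝ] (u₁ → ℝ))
    (bu₂ : u₂ → g.Site) (bv₂ : v₂ → g.Site) (ev₂ : g.Loc → v₂ → ℝ) (A₂ : B.Cfg → (v₂ → ℝ) →ₗ[ℝ] (u₂ → ℝ))
    (hw₀ : ∀ (lam : g.Loc) (γ : ℝ) (x' : v₀), |ev₀ lam x'| ≤ g.len (bv₀ x') ^ γ * g.wNorm γ lam)
    (hw₁ : ∀ (lam : g.Loc) (γ : ℝ) (x' : v₁), |ev₁ lam x'| ≤ g.len (bv₁ x') ^ γ * g.wNorm γ lam)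
    (hw₂ : ∀ (lam : g.Loc) (γ : ℝ) (x' : v₂), |ev₂ lam x'| ≤ g.len (bv₂ x') ^ γ * g.wNorm γ lam)
    (hlen : ∀ y : g.Site, 0 < g.len y) :
    ∃ K : B9.KernelFamily g B, K.e = e ∧ K.h1 = h1 ∧ K.e4 = e4 ∧ K.h2 = h2 ∧ K.l2 = l2 ∧ K.glob 3 = g3 ∧
      (∀ U : B.Cfg, CoReadsGlob K 0 U bu₀ bv₀ ev₀ (A₀ U)) ∧ (∀ U : B.Cfg, CoReadsGlob K 1 U bu₁ bv₁ ev₁ (A₁ U)) ∧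
      (∀ U : B.Cfg, CoReadsGlob K 2 U bu₂ bv₂ ev₂ (A₂ U)) ∧
      (∀ U lam γ, 0 ≤ K.glob 0 U lam γ ∧ 0 ≤ K.glob 1 U lam γ ∧ 0 ≤ K.glob 2 U lam γ) ∧
      (∀ (U : B.Cfg) (lam : g.Loc) (γ : ℝ) (x : u₀), |A₀ U (ev₀ lam) x| ≤ K.glob 0 U lam γ * B9.pref4 (g.len (bu₀ x)) 0 * g.len (bu₀ x) ^ γ) ∧
      (∀ (U : B.Cfg) (lam : g.Loc) (γ : ℝ) (x : u₁), |A₁ U (ev₁ lam) x| ≤ K.glob 1 U lam γ * B9.pref4 (g.len (bu₁ x)) 1 * g.len (bu₁ x) ^ γ) ∧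
      (∀ (U : B.Cfg) (lam : g.Loc) (γ : ℝ) (x : u₂), |A₂ U (ev₂ lam) x| ≤ K.glob 2 U lam γ * B9.pref4 (g.len (bu₂ x)) 2 * g.len (bu₂ x) ^ γ) := by
  obtain ⟨gl₀, h0₀, hco₀, hdom₀⟩ := exists_glob_canonical (B := B) 0 bu₀ ev₀ A₀ hlen
  obtain ⟨gl₁, h0₁, hco₁, hdom₁⟩ := exists_glob_canonical (B := B) 1 bu₁ ev₁ A₁ hlen
  obtain ⟨gl₂, h0₂, hco₂, hdom₂⟩ := exists_glob_canonical (B := B) 2 bu₂ ev₂ A₂ hlen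
  refine ⟨⟨e, h1, e4, h2, l2, ![gl₀, gl₁, gl₂, g3]⟩, rfl, rfl, rfl, rfl, rfl, rfl,
    fun U => ⟨hw₀, fun lam γ C hC h => ?_⟩, fun U => ⟨hw₁, fun lam γ C hC h => ?_⟩, fun U => ⟨hw₂, fun lam γ C hC h => ?_⟩,
    fun U lam γ => ⟨?_, ?_, ?_⟩, fun U lam γ x => ?_, fun U lam γ x => ?_, fun U lam γ x => ?_⟩
  · simpa using hco₀ U lam γ C hC h
  · simpa using hco₁ U lam γ C hC h
  · simpa using hco₂ U lam γ C hC h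
  · simpa using h0₀ U lam γ
  · simpa using h0₁ U lam γ
  · simpa using h0₂ U lam γ
  · simpa using hdom₀ U lam γ x
  · simpa using hdom₁ U lam γ x
  · simpa using hdom₂ U lam γ x

end ThreeEntries

end Summit.QuantumFields.YangMills.Theorems.Prop7SectET3NormGCanonical

end
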